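import Summits.NavierStokesRegularity.FunctionalMining.TopEigStrainMixHeat
import HarnessLib

/-!
# FunctionalMining / NoGo — the symmetrised core `Φ_q + Ψ_q` for real `q > 2`: heat coercivity
# REDUCED to one finite-dimensional convex-splitting obligation on symmetric trace-free `3 × 3`
# tensors (door D-K6 (c), kernel side)

HONEST FRAMING. Search for candidate a priori estimates; no regularity claim. Nothing about
Navier–Stokes is proved or asserted in this file: static functional inequalities on the flat unit
torus and one implication between candidate a priori inequalities. Cell `pub-nsfunc`, no-go seat
(gen 38), kernel candidate K9; companion of the staged K7/K8
`NoGo/TopBotEigHeatCoerciveTwo(Sharp)` (the node `TopBotEigHeatCoercivePos 2`, kernel rate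
window `[8π²/3, 8π²]` at `q = 2`). This file proves the HEAT-SIDE half of the node for every real
`q > 2` and TYPES the other, finite-dimensional half.

WHAT IS PROVED [ours]:
* §1 `TopEig.TopBotEigSplitting q c` — typed hypothesis, nothing asserted: there are `M ≥ 0` and
  a convex `1`-Lipschitz `h : ℝ^{3×3} → ℝ` with `h(A) ≥ 0` and
  `λ(A)^q + λ(−A)^q = M·h(A)^q + c·‖A‖^q` for every symmetric trace-free `A` (`λ = TopEig.lam`,
  the top Rayleigh value; on a divergence-free strain `λ(S) = λ₁`, `λ(−S) = −λ₃`; Frobenius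
  norm). In words: after the strain share `c‖A‖^q` is removed, the density of `Φ_q + Ψ_q` is still
  the `q`-th power of an ADMISSIBLE density (convex, Lipschitz, non-negative: the heat sieve's
  class, SIEVELD §1).
* §2 `TopEig.admissibleMix_heatDissipation_ge` — the MIXTURE PRINCIPLE in generic form: for ANY
  admissible density `g`, constants `M, c ≥ 0`, real `q > 2`, and any functional `Φ` equal to
  `M·∫ g(S)^q + c·Z_q` on smooth divergence-free fields, `c·q·D_Z(v) ≤ heatDissipation Φ v`
  (`Z_q = torusStrainMoment q`, `D_Z = strainGradDissipation q`). The tree's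
  `TopEig.mix_heatDissipation_ge` is the case `g = λ⁺`; the proof is the same heat-line argument:
  both parts are convex along `v + tΔv`, `heatDissipation` is minus the right derivative
  (`heatDissipation_eq_neg_rightDeriv`), the admissible part dissipates by the heat sieve
  (`heatDissipation_nonneg_of_admissible`), and the `Z_q` slope is controlled by
  `strainMoment_line_sub_le` and `strainLinePairing_laplacian_zero_le`.
* §3 `TopEig.topBotEigMoment_eq_of_splitting` (`Φ_q + Ψ_q = M ∫ h(S)^q + c Z_q` on smooth
  divergence-free fields), `TopEig.torusNegBotEigMoment_le_torusStrainMoment` (`Ψ_q ≤ Z_q`),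
  `TopEig.topBotEigMoment_heatCoercive_of_splitting (hq : 2 < q) (hc : 0 ≤ c)
  (hS : TopBotEigSplitting q c) : HeatCoercive (Φ_q + Ψ_q) (c·q/(2·npConst q))`, and
  **`TopEig.topBotEigHeatCoercivePos_of_splitting (hq : 2 < q) (hc : 0 < c)
  (hS : TopBotEigSplitting q c) : TopBotEigHeatCoercivePos q`** — the kernel node of D-K6 (c) for
  real `q > 2` FOLLOWS from the finite-dimensional obligation with a positive strain share
  (`Φ_q + Ψ_q ≤ 2Z_q ≤ 2·npConst(q)·D_Z`).

WHAT IS NOT PROVED, EXACTLY. `TopBotEigSplitting q c` for some `c > 0`, i.e. that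
`A ↦ λ₁(A)^q + (−λ₃(A))^q − c‖A‖^q` is the `q`-th power of a convex gauge on symmetric trace-free
`3 × 3` tensors. Pen status (no-go records, `sieveld/x2c/TOPBOT-COERCIVE-SPLIT-NOTE.md`): expected
TRUE for every real `q ≥ 2` with an explicit `c(q) > 0` — at `q = 2` it is the identity
`λ₁² + λ₃² = (4/3)·((λ₁−λ₃)/2)² + ‖A‖²/3` of the staged K7 (`M = 4/3`, `h` = the gap density,
`c = 1/3`), and for `q > 2` a Hessian floor follows from that identity and the convexity of
`s ↦ s^{q/2}`; its kernel proof (local-to-global convexity along lines, the gauge of `{k ≤ 1}`) is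
a separate file. At `c = 0` the obligation holds for every `q ≥ 1` (`M = 2`,
`h = ((λ⁺(A))^q/2 + (λ⁺(−A))^q/2)^{1/q}`, the staged K5 `NoGo/TopBotEigSaturatingSup` density),
so the whole content of the node is the positive share `c > 0`. `q = 2` is not covered by §2–§3
(the exponent `q/2 − 1 > 0` enters through the tree's nonlinear Poincaré inequality
`strainMoment_le_npConst_mul`); no rate is claimed to be sharp (`npConst` is crude).

PROVENANCE / STATUS. The no-go seat (gen 38) typed and farm-checked this file; STATUS: STAGED
(`pub-nsfunc-nogo/NoGo/TopBotEigHeatCoerciveSplit.STAGING.lean`), filing by a prove seat on the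
lead's word (the planner seat cannot file under `FunctionalMining/`). Search for candidate a priori
estimates; no regularity claim. [ours; K1-Q6 (c) = door D-K6 (c), heat side, `q > 2`]
FILING (prove seat g26, REQUEST #23): declarations byte-identical to the no-go seat's staged `TopBotEigHeatCoerciveSplit.STAGING.lean` b38da9db441356f8; this line is the only addition.
-/
open MeasureTheory Set Filter Topology Finset
open scoped InnerProductSpace RealInnerProductSpace ContDiff

namespace Summit.NavierStokesRegularity.FunctionalMining

open Literature.Analysis.FunctionSpaces Literature.Analysis.FunctionSpaces.Torus
  Literature.Analysis.FluidPDE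

namespace TopEig

open StrainL4 StrainMoment

/-! ## 1. The finite-dimensional obligation -/

/-- **Convex splitting of the symmetrised density with strain share `c`** (typed hypothesis; nothing
is asserted): `∃ M ≥ 0, ∃ h` convex and `1`-Lipschitz on `ℝ^{3×3}` with `h(A) ≥ 0` and
`λ(A)^q + λ(−A)^q = M·h(A)^q + c·‖A‖^q` for every symmetric trace-free `A`. Search for candidate a
priori estimates; no regularity claim. [ours; the finite-dimensional debt of D-K6 (c), `q > 2`] -/
def TopBotEigSplitting (q c : ℝ) : Prop :=
  ∃ M : ℝ, 0 ≤ M ∧ ∃ h : EuclideanSpace ℝ (Fin 3 × Fin 3) → ℝ,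
    ConvexOn ℝ univ h ∧ LipschitzWith 1 h ∧
      ∀ A : EuclideanSpace ℝ (Fin 3 × Fin 3), (∀ i j, A (i, j) = A (j, i)) →
        ∑ i, A (i, i) = 0 → 0 ≤ h A ∧ lam A ^ q + lam (-A) ^ q = M * h A ^ q + c * ‖A‖ ^ q

/-! ## 2. The mixture principle: an admissible core plus a strain share `c·Z_q` dissipates
`c·q·D_Z` -/

/-- **The right derivative of `M ∫ g(S)^q + c Z_q` along the heat line is `≤ −c q D_Z`.** For real
`q > 2`, `g` convex, `1`-Lipschitz and non-negative on divergence-free strains, `M, c ≥ 0`, any `Φ`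
that equals `M ∫ g(S)^q + c Z_q` on smooth divergence-free fields, and every smooth divergence-free
`v` on `T³`: `c q D_Z(v) ≤ heatDissipation Φ v`. [ours; generic form of `mix_heatDissipation_ge`] -/
theorem admissibleMix_heatDissipation_ge {q : ℝ} (hq : 2 < q)
    {g : EuclideanSpace ℝ (Fin 3 × Fin 3) → ℝ} (hconv : ConvexOn ℝ univ g)
    (hlip : LipschitzWith 1 g)
    (hg0 : ∀ v : UnitAddTorus (Fin 3) → EuclideanSpace ℝ (Fin 3), Torus.IsSmooth v →
      Torus.IsDivFree v → ∀ x, 0 ≤ g (strainFlat v x))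
    {M c : ℝ} (hM : 0 ≤ M) (hc : 0 ≤ c)
    {Φ : (UnitAddTorus (Fin 3) → EuclideanSpace ℝ (Fin 3)) → ℝ}
    (hΦ : ∀ v : UnitAddTorus (Fin 3) → EuclideanSpace ℝ (Fin 3), Torus.IsSmooth v →
      Torus.IsDivFree v → Φ v = M * (∫ x, g (strainFlat v x) ^ q) + c * torusStrainMoment q v)
    {v : UnitAddTorus (Fin 3) → EuclideanSpace ℝ (Fin 3)} (hv : Torus.IsSmooth v)
    (hdiv : Torus.IsDivFree v) :
    c * q * strainGradDissipation q v ≤ heatDissipation Φ v := by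
  have hq1 : (1 : ℝ) ≤ q := by linarith
  have hΔ : Torus.IsSmooth (Torus.laplacian v) := hv.laplacian
  have hv1 : Torus.IsContDiff 1 v := hv.isContDiff (by simp)
  have hΔ1 : Torus.IsContDiff 1 (Torus.laplacian v) := hΔ.isContDiff (by simp)
  have hline : ∀ t : ℝ, Torus.IsSmooth (v + t • Torus.laplacian v) ∧
      Torus.IsDivFree (v + t • Torus.laplacian v) := fun t =>
    ⟨isSmooth_heatLine hv t, isDivFree_add_smul hv hΔ hdiv (isDivFree_laplacian hv hdiv) t⟩
  -- the admissible part `H = ∫ g(S)^q`, as an opaque functional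
  obtain ⟨H, hH⟩ : ∃ H : (UnitAddTorus (Fin 3) → EuclideanSpace ℝ (Fin 3)) → ℝ,
      ∀ w, H w = ∫ x, g (strainFlat w x) ^ q := ⟨_, fun _ => rfl⟩
  have hHcvx : ConvexOn ℝ univ (fun t : ℝ => H (v + t • Torus.laplacian v)) := by
    have h := convexOn_integral_posPart_rpow_line (d := Fin 3) hconv hlip.continuous
      (continuous_strainFlat hv) (continuous_strainFlat hΔ) hq1
    refine h.congr fun t _ => ?_
    show (∫ x, max (g (strainFlat v x + t • strainFlat (Torus.laplacian v) x)) 0 ^ q) =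
      H (v + t • Torus.laplacian v)
    rw [hH]
    refine integral_congr_ae (ae_of_all _ fun x => ?_)
    show max (g (strainFlat v x + t • strainFlat (Torus.laplacian v) x)) 0 ^ q =
      g (strainFlat (v + t • Torus.laplacian v) x) ^ q
    rw [← strainFlat_add_smul hv1 hΔ1, max_eq_left (hg0 _ (hline t).1 (hline t).2 x)]
  have hZcvx : ConvexOn ℝ univ (fun t : ℝ => torusStrainMoment q (v + t • Torus.laplacian v)) :=
    convexOn_strainMoment_line hq1 hv hΔ
  have hΦ0 : Φ v = M * H v + c * torusStrainMoment q v := by rw [hΦ v hv hdiv, hH]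
  have hΦt : ∀ τ : ℝ, Φ (v + τ • Torus.laplacian v) = M * H (v + τ • Torus.laplacian v) +
      c * torusStrainMoment q (v + τ • Torus.laplacian v) := fun τ => by
    rw [hΦ _ (hline τ).1 (hline τ).2, hH]
  have hcvx : ConvexOn ℝ univ (fun t : ℝ => Φ (v + t • Torus.laplacian v)) := by
    refine ((ConvexOn.smul hM hHcvx).add (ConvexOn.smul hc hZcvx)).congr fun t _ => ?_
    simp only [Pi.add_apply, smul_eq_mul]
    exact (hΦt t).symm
  -- `heatDissipation` is minus the right derivative, for `Φ` and for the admissible part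
  obtain ⟨hder, heq⟩ := heatDissipation_eq_neg_rightDeriv (d := Fin 3) (Φ := Φ) (v := v) hcvx
  obtain ⟨hderH, heqH⟩ := heatDissipation_eq_neg_rightDeriv (d := Fin 3) (Φ := H) (v := v) hHcvx
  rw [heq]
  set D := derivWithin (fun t : ℝ => Φ (v + t • Torus.laplacian v)) (Set.Ioi 0) 0 with hD
  set DH := derivWithin (fun t : ℝ => H (v + t • Torus.laplacian v)) (Set.Ioi 0) 0 with hDH
  have hDH0 : DH ≤ 0 := by
    have h0 : 0 ≤ heatDissipation H v :=
      heatDissipation_nonneg_of_admissible hq1 hconv hlip hg0 (Φ := H) (fun w _ _ => hH w) hv hdiv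
    rw [heqH] at h0
    linarith
  have ht := (hasDerivWithinAt_iff_tendsto_slope' self_notMem_Ioi).mp hder
  have htH := (hasDerivWithinAt_iff_tendsto_slope' self_notMem_Ioi).mp hderH
  -- the slope of `Φ`, eventually, and its limit
  set ψ := strainLinePairing q v (Torus.laplacian v) with hψ
  have hψc : Continuous ψ := continuous_strainLinePairing hq hv hΔ
  have hev : ∀ᶠ τ in 𝓝[>] (0 : ℝ),
      slope (fun t : ℝ => Φ (v + t • Torus.laplacian v)) 0 τ ≤
      M * slope (fun t : ℝ => H (v + t • Torus.laplacian v)) 0 τ + c * ψ τ := by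
    filter_upwards [self_mem_nhdsWithin] with τ (hτ : 0 < τ)
    have hZ : torusStrainMoment q (v + τ • Torus.laplacian v) - torusStrainMoment q v ≤ τ * ψ τ :=
      strainMoment_line_sub_le hq hv hΔ τ
    rw [slope_def_field, slope_def_field, sub_zero]
    simp only [zero_smul, add_zero]
    rw [hΦt τ, hΦ0, div_le_iff₀ hτ]
    calc M * H (v + τ • Torus.laplacian v) + c * torusStrainMoment q (v + τ • Torus.laplacian v) -
          (M * H v + c * torusStrainMoment q v)
        = M * (H (v + τ • Torus.laplacian v) - H v) +
          c * (torusStrainMoment q (v + τ • Torus.laplacian v) - torusStrainMoment q v) := by ring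
      _ ≤ M * (H (v + τ • Torus.laplacian v) - H v) + c * (τ * ψ τ) :=
          add_le_add le_rfl (mul_le_mul_of_nonneg_left hZ hc)
      _ = (M * ((H (v + τ • Torus.laplacian v) - H v) / τ) + c * ψ τ) * τ := by
          rw [add_mul, mul_assoc M, div_mul_cancel₀ _ hτ.ne']
          ring
  have hlim : Tendsto (fun τ : ℝ =>
      M * slope (fun t : ℝ => H (v + t • Torus.laplacian v)) 0 τ + c * ψ τ)
      (𝓝[>] (0 : ℝ)) (𝓝 (M * DH + c * ψ 0)) :=
    (htH.const_mul M).add (((hψc.tendsto 0).mono_left nhdsWithin_le_nhds).const_mul c)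
  have hDle : D ≤ M * DH + c * ψ 0 := le_of_tendsto_of_tendsto ht hlim hev
  have hψ0 : ψ 0 ≤ -(q * strainGradDissipation q v) :=
    strainLinePairing_laplacian_zero_le hq hv
  have ha : M * DH ≤ 0 := mul_nonpos_of_nonneg_of_nonpos hM hDH0
  have hb : c * ψ 0 ≤ c * (-(q * strainGradDissipation q v)) := mul_le_mul_of_nonneg_left hψ0 hc
  linarith

/-! ## 3. The symmetrised core under the splitting hypothesis -/

/-- **`Φ_q + Ψ_q = M ∫ h(S)^q + c Z_q`** on smooth divergence-free fields of `T³`, whenever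
`λ(A)^q + λ(−A)^q = M h(A)^q + c‖A‖^q` on symmetric trace-free tensors (`h` continuous, `q > 0`).
[ours] -/
theorem topBotEigMoment_eq_of_splitting {q M c : ℝ} (hq : 0 < q)
    {h : EuclideanSpace ℝ (Fin 3 × Fin 3) → ℝ} (hcont : Continuous h)
    (hid : ∀ A : EuclideanSpace ℝ (Fin 3 × Fin 3), (∀ i j, A (i, j) = A (j, i)) →
      ∑ i, A (i, i) = 0 → lam A ^ q + lam (-A) ^ q = M * h A ^ q + c * ‖A‖ ^ q)
    {v : UnitAddTorus (Fin 3) → EuclideanSpace ℝ (Fin 3)} (hv : Torus.IsSmooth v)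
    (hdiv : Torus.IsDivFree v) :
    topBotEigMoment (d := Fin 3) q v =
      M * (∫ x, h (strainFlat v x) ^ q) + c * torusStrainMoment q v := by
  have hc1 : Continuous fun x => lam (strainFlat v x) ^ q :=
    (lipschitzWith_lam.continuous.comp (continuous_strainFlat hv)).rpow_const fun _ => Or.inr hq.le
  have hc2 : Continuous fun x => lam (-strainFlat v x) ^ q :=
    (lipschitzWith_lam.continuous.comp (continuous_strainFlat hv).neg).rpow_const
      fun _ => Or.inr hq.le
  have hc3 : Continuous fun x => h (strainFlat v x) ^ q :=
    (hcont.comp (continuous_strainFlat hv)).rpow_const fun _ => Or.inr hq.le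
  have hc4 : Continuous fun x => ‖strainFlat v x‖ ^ q :=
    (continuous_strainFlat hv).norm.rpow_const fun _ => Or.inr hq.le
  have hpt : ∀ x, lam (strainFlat v x) ^ q + lam (-strainFlat v x) ^ q =
      M * h (strainFlat v x) ^ q + c * ‖strainFlat v x‖ ^ q := fun x =>
    hid _ (strainFlat_symm v x) (sum_diag_strainFlat_eq_zero hv hdiv x)
  unfold topBotEigMoment
  rw [torusTopEigMoment_eq hv hdiv q, torusNegBotEigMoment_eq hv hdiv q,
    torusStrainMoment_eq_integral_norm q v,
    ← integral_add hc1.integrable_unitAddTorus hc2.integrable_unitAddTorus]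
  simp_rw [hpt]
  rw [integral_add (hc3.integrable_unitAddTorus.const_mul _)
      (hc4.integrable_unitAddTorus.const_mul _), integral_const_mul, integral_const_mul]

/-- `Ψ_q ≤ Z_q` on smooth divergence-free fields of `T³` (`−λ₃ = λ(−S) ≤ ‖S‖`). [ours] -/
theorem torusNegBotEigMoment_le_torusStrainMoment {q : ℝ} (hq : 0 < q)
    {v : UnitAddTorus (Fin 3) → EuclideanSpace ℝ (Fin 3)} (hv : Torus.IsSmooth v)
    (hdiv : Torus.IsDivFree v) : torusNegBotEigMoment q v ≤ torusStrainMoment q v := by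
  rw [torusNegBotEigMoment_eq hv hdiv q, torusStrainMoment_eq_integral_norm q v]
  have hc1 : Continuous fun x => lam (-strainFlat v x) ^ q :=
    (lipschitzWith_lam.continuous.comp (continuous_strainFlat hv).neg).rpow_const
      fun _ => Or.inr hq.le
  have hc2 : Continuous fun x => ‖strainFlat v x‖ ^ q :=
    (continuous_strainFlat hv).norm.rpow_const fun _ => Or.inr hq.le
  exact integral_mono hc1.integrable_unitAddTorus hc2.integrable_unitAddTorus fun x =>
    Real.rpow_le_rpow (lam_neg_strainFlat_nonneg hv hdiv x)
      ((lam_le_norm _).trans (norm_neg _).le) hq.le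

/-- `Φ_q + Ψ_q ≤ 2 Z_q` on smooth divergence-free fields of `T³` (`q > 0`). [ours, bookkeeping] -/
theorem topBotEigMoment_le_two_mul_strainMoment {q : ℝ} (hq : 0 < q)
    {v : UnitAddTorus (Fin 3) → EuclideanSpace ℝ (Fin 3)} (hv : Torus.IsSmooth v)
    (hdiv : Torus.IsDivFree v) : topBotEigMoment (d := Fin 3) q v ≤ 2 * torusStrainMoment q v := by
  have h1 := torusTopEigMoment_le_torusStrainMoment hq hv hdiv
  have h2 := torusNegBotEigMoment_le_torusStrainMoment hq hv hdiv
  unfold topBotEigMoment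
  linarith

/-- **Under the splitting hypothesis, `heatDissipation (Φ_q + Ψ_q) v ≥ c q D_Z(v)`** for real
`q > 2`, `c ≥ 0` and every smooth divergence-free `v` on `T³`. [ours] -/
theorem topBotEigMoment_heatDissipation_ge_of_splitting {q c : ℝ} (hq : 2 < q) (hc : 0 ≤ c)
    (hS : TopBotEigSplitting q c) {v : UnitAddTorus (Fin 3) → EuclideanSpace ℝ (Fin 3)}
    (hv : Torus.IsSmooth v) (hdiv : Torus.IsDivFree v) :
    c * q * strainGradDissipation q v ≤ heatDissipation (topBotEigMoment (d := Fin 3) q) v := by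
  obtain ⟨M, hM, h, hconv, hlip, hA⟩ := hS
  have hq0 : (0 : ℝ) < q := by linarith
  exact admissibleMix_heatDissipation_ge hq hconv hlip
    (fun w hw hdw x => (hA _ (strainFlat_symm w x) (sum_diag_strainFlat_eq_zero hw hdw x)).1) hM hc
    (fun w hw hdw => topBotEigMoment_eq_of_splitting hq0 hlip.continuous
      (fun A hs ht => (hA A hs ht).2) hw hdw) hv hdiv

/-- **Heat coercivity of `Φ_q + Ψ_q` from the splitting**: for real `q > 2` and `c ≥ 0`,
`TopBotEigSplitting q c → HeatCoercive (Φ_q + Ψ_q) (c q / (2 npConst q))`. [ours] -/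
theorem topBotEigMoment_heatCoercive_of_splitting {q c : ℝ} (hq : 2 < q) (hc : 0 ≤ c)
    (hS : TopBotEigSplitting q c) :
    HeatCoercive (d := Fin 3) (topBotEigMoment q) (c * q / (2 * npConst q)) := by
  intro _ v hv hdiv _
  have hq0 : (0 : ℝ) < q := by linarith
  have hC := npConst_pos hq
  have hdiss := topBotEigMoment_heatDissipation_ge_of_splitting hq hc hS hv hdiv
  have hNP := strainMoment_le_npConst_mul hq hv
  have h2 := topBotEigMoment_le_two_mul_strainMoment hq0 hv hdiv
  have hr : 0 ≤ c * q / (2 * npConst q) := by positivity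
  calc c * q / (2 * npConst q) * topBotEigMoment q v
      ≤ c * q / (2 * npConst q) * (2 * torusStrainMoment q v) := mul_le_mul_of_nonneg_left h2 hr
    _ = c * q / npConst q * torusStrainMoment q v := by
        field_simp
    _ ≤ c * q / npConst q * (npConst q * strainGradDissipation q v) :=
        mul_le_mul_of_nonneg_left hNP (by positivity)
    _ = c * q * strainGradDissipation q v := by
        field_simp
    _ ≤ heatDissipation (topBotEigMoment q) v := hdiss

/-- **The kernel node of D-K6 (c) for real `q > 2`, from the finite-dimensional obligation**:
`TopBotEigSplitting q c` with `c > 0` gives `TopBotEigHeatCoercivePos q` (witness rate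
`c q / (2 npConst q)`). Search for candidate a priori estimates; no regularity claim. [ours] -/
theorem topBotEigHeatCoercivePos_of_splitting {q c : ℝ} (hq : 2 < q) (hc : 0 < c)
    (hS : TopBotEigSplitting q c) : TopBotEigHeatCoercivePos (d := Fin 3) q :=
  ⟨c * q / (2 * npConst q), by have := npConst_pos hq; positivity,
    topBotEigMoment_heatCoercive_of_splitting hq hc.le hS⟩

end TopEig

end Summit.NavierStokesRegularity.FunctionalMining
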